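import Summits.HodgeConjecture.HodgeConjecture.Theorems.HodgeLocusCensusSchema
import HarnessLib
import HarnessLib.Audit.Tags
/-!
# HodgeLocusCensusGrassmannianCells — the (n,4) mixed Aoki–Shioda cells δ = [Z] ± [Π′] on the Fermat quartic n-fold, n = 4, 6, 8: the Gr(2,5)-section (+)-cells (EXPLAINED-SMOOTH) and the (−)-cells (NOT (α)) (cell pub-hlocus, lead gen 4; COMPONENTS.md (C5)/(T16)/(T18)/(T18d), REFEREE.md R31/R32/R34)
HONEST FRAMING: certified instances and evidence bearing on the general Hodge conjecture; no claim.

Setting. X_F ⊂ ℙ^{n+1} the Fermat quartic, ζ = ζ₈, yⱼ the linear forms y₁ = x₀ − ζx₁, y₂ = x₀ − ζ⁷x₁, y₃ = x₂ − ζx₃, y₄ = x₂ + ζx₃,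
y₅ = x₄ − ζx₅, y₆ = x₄ − ζ³x₅. Z = the Aoki–Shioda complete intersection V(f₁, f₂, y₅[, ℓ₆₇, ℓ₈₉]) (f₁ = x₂² − κx₀x₁, f₂ = x₀² + x₁² + i x₃²,
κ = ζ + ζ⁷, i = ζ²), Π′ = V(y₁, y₃, y₆[, ℓ₆₇, ℓ₈₉]) the linear cycle over the line L = V(y₁, y₃) ⊂ S_F from the other vertex on the pair (4,5),
Π(α,β) = V(x₀ − ζ^α x₁, x₂ − ζ^β x₃, y₅[, …]). The cell PROVED (T16c) the class identity [Z] = [Π(1,1)] + [Π(1,5)] + [Π(7,1)] + [Π(7,5)]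
(elliptic pencil on S_F; det-Jac cross-check P_Z = Σ P_Π identically for n = 4, 6, 8), so δ±′ = [Z] ± [Π′] is a signed sum of FIVE LINEAR
cycles and its Movasati matrix is an instance of the schema (`period`, b = id). What is TYPED here (OPEN Props, kind census-row): the first-order
ranks 16 / 53 / 119 of δ±′, the ranks 11 / 36 / 83 of [Z] and 6 / 19 / 45 of [Π′], and the stacked ranks 17 / 54 / 120 (dim T_Z ∩ T_Π′ =
109 / 276 / 595) — every number by ≥ 2 implementations sharing no code (engine A exact over ℚ(ζ₈): hlocus/pmA, kit j080552; engine B: as_dp5 /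
twistcone, kit j076854 / j074193; referee R31/R32/R34 mod two primes; plus an independent re-implementation of THIS FILE's `period` formula mod
p = 1048601, 1048609 on the five-plane encodings below, lead gen 4). What is PROVED here (kernel, no sorry) is the algebra behind the two verdicts:
(+) EXPLAINED-SMOOTH — V_{[Z]+[Π′]} at X_F = closure of {quartic n-folds containing a linear section of Gr(2,5)} (dP5 / V₅ / Gr(2,5) ∩ ℙ⁷), via the
flat degeneration of the explicit codimension-3 Pfaffian Pf(M⁰) to the five planes W₀ = Π(1,1) ∪ Π(1,5) ∪ Π(7,1) ∪ Π(7,5) ∪ Π′ (T16d): the Pfaffian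
vector of M⁰ and its Buchsbaum–Eisenbud syzygy M⁰·p = 0, the set-theoretic decomposition V(Pf M⁰) = quadric ∪ three planes, the w-leading terms =
the Stanley–Reisner ideal of the 2-DISK Δ (f = (6,10,5), minimal non-faces 12, 15, 34, 35, 56), Stanley's HF = (5k²+5k+2)/2 = the Buchsbaum–Eisenbud
HF (k ≤ 12; both sides are polynomials of degree ≤ 5 in k), the Gr(2,5) section numbers 51 / 105 / 190 and the dimension count 75+35 / 225+52 /
525+71 = 126−16 / 330−53 / 715−119 (R32's third route); the pencil identities (f₁+g₂) ± (f₂−g₁) = 2y₁y₂, 2y₃y₄ behind [Z] = Σ[Π(α,β)]; W₀ ⊂ X_F.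
(−) NOT (α) — fat point of length 2 on a complementary slice (A = B = R on X⁴/X⁶/X⁸): only the accounting e = 1, component bound dim S₄ − stack
= 109 / 276 / 595 < dim T is kernel arithmetic; the order-2 obstruction is the cited three-implementation evidence (data/ivhs/AS/A-pm_*.json,
B (β) j074193, data/ivhs/census/refg17|18|20). Geometric identifications are COMPONENTS.md evidence, not part of the typed Props.
-/
namespace Summit.HodgeConjecture.HodgeConjecture.HodgeLocus.Census.GrSection

/-! ## Typed census rows (OPEN in Lean; the numbers are certified by ≥ 2 implementations each) -/

/-- the 3-plane P(a₁,a₃,a₅,a₇) := {x_{2e} = ζ^{1+2a_{2e+1}} x_{2e+1}, e = 0..3} of the Fermat quartic sixfold X⁴₆, b = id. -/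
def plane64 (a1 a3 a5 a7 : ℕ) : LinearCycle 6 := ⟨![0, a1, 0, a3, 0, a5, 0, a7], 1⟩
/-- the 4-plane P(a₁,a₃,a₅,a₇,a₉) of the Fermat quartic eightfold X⁴₈, b = id. -/
def plane84 (a1 a3 a5 a7 a9 : ℕ) : LinearCycle 8 := ⟨![0, a1, 0, a3, 0, a5, 0, a7, 0, a9], 1⟩

/-- [Z] on X⁴₄ as the four planes Π(1,1)+Π(1,5)+Π(7,1)+Π(7,5) (T16c): Π(α,β) = plane44 ((α−1)/2) ((β−1)/2) 0. -/
def fourPlanes4 : List (ℚ × LinearCycle 4) := [(1, plane44 0 0 0), (1, plane44 0 2 0), (1, plane44 3 0 0), (1, plane44 3 2 0)]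
/-- [Z] on X⁴₆ (tails (4,5,1),(6,7,1)). -/
def fourPlanes6 : List (ℚ × LinearCycle 6) := [(1, plane64 0 0 0 0), (1, plane64 0 2 0 0), (1, plane64 3 0 0 0), (1, plane64 3 2 0 0)]
/-- [Z] on X⁴₈ (tails (4,5,1),(6,7,1),(8,9,1)). -/
def fourPlanes8 : List (ℚ × LinearCycle 8) :=
  [(1, plane84 0 0 0 0 0), (1, plane84 0 2 0 0 0), (1, plane84 3 0 0 0 0), (1, plane84 3 2 0 0 0)]
/-- Π′ = V(x₀ − ζx₁, x₂ − ζx₃, x₄ − ζ³x₅) ⊂ X⁴₄. -/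
def piPrime4 : LinearCycle 4 := plane44 0 0 1
/-- Π′ = V(x₀ − ζx₁, x₂ − ζx₃, x₄ − ζ³x₅, x₆ − ζx₇) ⊂ X⁴₆. -/
def piPrime6 : LinearCycle 6 := plane64 0 0 1 0
/-- Π′ = V(x₀ − ζx₁, x₂ − ζx₃, x₄ − ζ³x₅, x₆ − ζx₇, x₈ − ζx₉) ⊂ X⁴₈. -/
def piPrime8 : LinearCycle 8 := plane84 0 0 1 0 0

/-- (4,4) (+)-cell δ₊′ = [Z] + [Π′]: rank 16 (dim T = 110, e = 1 over dim T_Z ∩ T_Π′ = 109). EXPLAINED-SMOOTH (T16)/(C5)/R32: V_δ at X_F =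
closure of {quartic fourfolds containing a quintic del Pezzo surface dP5 = Gr(2,5) ∩ ℙ⁵}, smooth of dimension 110 = 75 + 35; flat limit cycle
W₀ = five planes. Engines A (hlocus exact; dp5A/dp5degA), B (as_dp5 j076854), R32 by hand; this file's formula re-implemented mod two primes. OPEN in Lean. -/
@[conjecture] def explainedSmooth_4_4_ZplusPiPrime : Prop :=
  ExplainedSmoothRow 4 4 16 [(1, plane44 0 0 0), (1, plane44 0 2 0), (1, plane44 3 0 0), (1, plane44 3 2 0), (1, plane44 0 0 1)]
/-- (6,4) (+)-cell: rank 53 (dim T = 277 = 225 + 52). EXPLAINED-SMOOTH: del Pezzo threefold V₅ = Gr(2,5) ∩ ℙ⁶ in a hyperplane of ℙ⁷ (T16)/(C5)/R32;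
supersedes R31's OI-11 suggestion for this cell. OPEN in Lean. -/
@[conjecture] def explainedSmooth_6_4_ZplusPiPrime : Prop :=
  ExplainedSmoothRow 6 4 53
    [(1, plane64 0 0 0 0), (1, plane64 0 2 0 0), (1, plane64 3 0 0 0), (1, plane64 3 2 0 0), (1, plane64 0 0 1 0)]
/-- (8,4) (+)-cell: rank 119 (dim T = 596 = 525 + 71). EXPLAINED-SMOOTH: Gr(2,5) ∩ ℙ⁷ ⊂ ℙ⁹ (T16)/(C5)/R32; R34(c) λ = +1 control lifts. OPEN in Lean. -/
@[conjecture] def explainedSmooth_8_4_ZplusPiPrime : Prop :=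
  ExplainedSmoothRow 8 4 119
    [(1, plane84 0 0 0 0 0), (1, plane84 0 2 0 0 0), (1, plane84 3 0 0 0 0), (1, plane84 3 2 0 0 0), (1, plane84 0 0 1 0 0)]

/-- (4,4) (−)-cell δ₋′ = [Z] − [Π′]: rank 16 as well (dim T = 110 > 109 = dim T_Z ∩ T_Π′). NOT (α): V_δ ∩ (F + Λ′) is a FAT POINT of length 2
(HS (1,2,2), m² ⊆ I) on complementary slices — engine A pmA.py (T18b), engine B (β) twistcone j074193, referee R32(b) (every first-order direction
obstructed at order 2); so every component of V_δ through X_F has dimension ≤ 109 and V_δ is singular at X_F. Candidate non-reduced structure over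
V_Z ∩ V_Π′ = open row r2 (not typed). Only the rank is typed. OPEN in Lean. -/
@[conjecture] def notAlpha_4_4_ZminusPiPrime : Prop :=
  IvhsRankEq 4 4 16 [(1, plane44 0 0 0), (1, plane44 0 2 0), (1, plane44 3 0 0), (1, plane44 3 2 0), (-1, plane44 0 0 1)]
/-- (6,4) (−)-cell: rank 53; NOT (α) (fat point length 2: A (T18b), B (β), R31). OPEN in Lean. -/
@[conjecture] def notAlpha_6_4_ZminusPiPrime : Prop :=
  IvhsRankEq 6 4 53
    [(1, plane64 0 0 0 0), (1, plane64 0 2 0 0), (1, plane64 3 0 0 0), (1, plane64 3 2 0 0), (-1, plane64 0 0 1 0)]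
/-- (8,4) (−)-cell: rank 119; NOT (α) (fat point length 2: A (T18d) kit j080552, B (β), R34 on A's 120-direction slice). OPEN in Lean. -/
@[conjecture] def notAlpha_8_4_ZminusPiPrime : Prop :=
  IvhsRankEq 8 4 119
    [(1, plane84 0 0 0 0 0), (1, plane84 0 2 0 0 0), (1, plane84 3 0 0 0 0), (1, plane84 3 2 0 0 0), (-1, plane84 0 0 1 0 0)]

/-- first-order rank of [Z] as four planes on X⁴₄: 11 (A exact = B = R; = the single Aoki–Shioda CI(2,2,1) rank of HodgeLocusCensusAokiShiodaRows). OPEN in Lean. -/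
@[conjecture] def rankZ_4_4 : Prop := IvhsRankEq 4 4 11 fourPlanes4
/-- rank M_Z = 36 on X⁴₆ (= single CI(2,2,1,1) rank; A exact = B = R31). OPEN in Lean. -/
@[conjecture] def rankZ_6_4 : Prop := IvhsRankEq 6 4 36 fourPlanes6
/-- rank M_Z = 83 on X⁴₈ (= single CI(2,2,1,1,1) rank; A exact (T18d) = B = R34(c)). OPEN in Lean. -/
@[conjecture] def rankZ_8_4 : Prop := IvhsRankEq 8 4 83 fourPlanes8
/-- rank M_Π′ = 6 on X⁴₄ (a single plane; A exact = B). OPEN in Lean. -/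
@[conjecture] def rankPiPrime_4_4 : Prop := IvhsRankEq 4 4 6 [(1, piPrime4)]
/-- rank M_Π′ = 19 on X⁴₆ (a single 3-plane; A exact (T18a) = B). OPEN in Lean. -/
@[conjecture] def rankPiPrime_6_4 : Prop := IvhsRankEq 6 4 19 [(1, piPrime6)]
/-- rank M_Π′ = 45 on X⁴₈ (a single 4-plane; A exact (T18d) = B = R34(c)). OPEN in Lean. -/
@[conjecture] def rankPiPrime_8_4 : Prop := IvhsRankEq 8 4 45 [(1, piPrime8)]
/-- STACKED-RANK rows (statement kind: per-row; characteristic zero only, R16 convention): rank [M_Z; M_Π′] = 17 / 54 / 120 over ℚ(ζ₈), i.e.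
codim (ker M_Z ∩ ker M_Π′) = dim S₄ − dim T_Z ∩ T_Π′ with dim T_Z ∩ T_Π′ = 126 − 17 = 109, 330 − 54 = 276, 715 − 120 = 595 (A exact = B = R;
T = ker M by Movasati Thm. 6, cited): T_Z, T_Π′ transversal in S₄ for n = 4 (17 = 11 + 6), NOT for n = 6, 8 (54 < 55, 120 < 128). OPEN in Lean. -/
@[conjecture] def stackRank_4_4 : Prop :=
  ∀ (K : Type) [Field K] [CharZero K] (ζ : K), IsPrimitiveRoot ζ (2*4) →
    (Matrix.fromRows (ivhsMatrix 4 4 ζ fourPlanes4) (ivhsMatrix 4 4 ζ [(1, piPrime4)])).rank = 17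
/-- stacked rank [M_Z; M_Π′] = 54 on X⁴₆ (dim T_Z ∩ T_Π′ = 276; 54 < 36 + 19). OPEN in Lean. -/
@[conjecture] def stackRank_6_4 : Prop :=
  ∀ (K : Type) [Field K] [CharZero K] (ζ : K), IsPrimitiveRoot ζ (2*4) →
    (Matrix.fromRows (ivhsMatrix 6 4 ζ fourPlanes6) (ivhsMatrix 6 4 ζ [(1, piPrime6)])).rank = 54
/-- stacked rank [M_Z; M_Π′] = 120 on X⁴₈ (dim T_Z ∩ T_Π′ = 595; 120 < 83 + 45). OPEN in Lean. -/
@[conjecture] def stackRank_8_4 : Prop :=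
  ∀ (K : Type) [Field K] [CharZero K] (ζ : K), IsPrimitiveRoot ζ (2*4) →
    (Matrix.fromRows (ivhsMatrix 8 4 ζ fourPlanes8) (ivhsMatrix 8 4 ζ [(1, piPrime8)])).rank = 120

/-! ## (T16d) the explicit codimension-3 Pfaffian M⁰ degenerating to W₀ (PROVED) -/

variable {R : Type*} [CommRing R]

/-- the integer skew 5 × 5 matrix M⁰ of linear forms: m₁₂ = y₅, m₃₄ = y₆, m₃₅ = y₁, m₄₅ = y₃, m₁₄ = −y₂, m₂₃ = y₄ − y₂, all other m_{ij} (i<j) = 0. -/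
def M0 (y₁ y₂ y₃ y₄ y₅ y₆ : R) : Matrix (Fin 5) (Fin 5) R :=
  !![0, y₅, 0, -y₂, 0;
     -y₅, 0, y₄ - y₂, 0, 0;
     0, -(y₄ - y₂), 0, y₆, y₁;
     y₂, 0, -y₆, 0, y₃;
     0, 0, -y₁, -y₃, 0]

/-- the 4 × 4 sub-Pfaffian on rows/columns p < q < r < s of a skew matrix: m_pq m_rs − m_pr m_qs + m_ps m_qr. -/
def pf4 (mpq mpr mps mqr mqs mrs : R) : R := mpq * mrs - mpr * mqs + mps * mqr

/-- the five 4 × 4 Pfaffians of M⁰ (deleting 5, 4, 3, 2, 1): Pf₁₂₃₄ = y₅y₆ + y₂² − y₂y₄, Pf₁₂₃₅ = y₁y₅, Pf₁₂₄₅ = y₃y₅, Pf₁₃₄₅ = y₁y₂,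
Pf₂₃₄₅ = y₃y₄ − y₂y₃ (engine A dp5degA.py 'Pfaffians'). -/
theorem pfaffians_M0 (y₁ y₂ y₃ y₄ y₅ y₆ : R) :
    pf4 y₅ 0 (-y₂) (y₄ - y₂) 0 y₆ = y₅ * y₆ + y₂ ^ 2 - y₂ * y₄ ∧ pf4 y₅ 0 0 (y₄ - y₂) 0 y₁ = y₁ * y₅ ∧
    pf4 y₅ (-y₂) 0 0 0 y₃ = y₃ * y₅ ∧ pf4 0 (-y₂) 0 y₆ y₁ y₃ = y₁ * y₂ ∧ pf4 (y₄ - y₂) 0 0 y₆ y₁ y₃ = y₃ * y₄ - y₂ * y₃ := by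
  refine ⟨?_, ?_, ?_, ?_, ?_⟩ <;> simp only [pf4] <;> ring

/-- M⁰ is skew-symmetric. -/
theorem M0_transpose (y₁ y₂ y₃ y₄ y₅ y₆ : R) : (M0 y₁ y₂ y₃ y₄ y₅ y₆).transpose = -M0 y₁ y₂ y₃ y₄ y₅ y₆ := by
  ext i j; fin_cases i <;> fin_cases j <;> simp [M0]

/-- BUCHSBAUM–EISENBUD SYZYGY: M⁰ · (Pf_1̂, −Pf_2̂, Pf_3̂, −Pf_4̂, Pf_5̂)ᵀ = 0 (Pf_k̂ = the Pfaffian deleting row/column k), certifying that the five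
quadrics ARE the signed sub-maximal Pfaffians of M⁰ (first map of the Buchsbaum–Eisenbud complex 0 → S(−5) → S(−3)⁵ → S(−2)⁵ → S). -/
theorem M0_mulVec_pfaffians (y₁ y₂ y₃ y₄ y₅ y₆ : R) :
    (M0 y₁ y₂ y₃ y₄ y₅ y₆).mulVec ![y₃ * y₄ - y₂ * y₃, -(y₁ * y₂), y₃ * y₅, -(y₁ * y₅), y₅ * y₆ + y₂ ^ 2 - y₂ * y₄] = 0 := by
  ext i; fin_cases i <;> simp [M0, Matrix.mulVec, dotProduct, Fin.sum_univ_five] <;> ring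

/-- (T16d)(i) set-theoretically V(Pf M⁰) = the quadric surface V(y₁, y₃, y₅y₆ + y₂² − y₂y₄) ∪ the planes V(y₂,y₃,y₅), V(y₂,y₄,y₅), V(y₁,y₅,y₂−y₄)
(degree 2+1+1+1 = 5, codimension 3), over any field. -/
theorem pfaffian_locus_decomposition {K : Type*} [Field K] (y₁ y₂ y₃ y₄ y₅ y₆ : K) :
    (y₅ * y₆ + y₂ ^ 2 - y₂ * y₄ = 0 ∧ y₁ * y₅ = 0 ∧ y₃ * y₅ = 0 ∧ y₁ * y₂ = 0 ∧ y₃ * y₄ - y₂ * y₃ = 0) ↔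
      ((y₁ = 0 ∧ y₃ = 0 ∧ y₅ * y₆ + y₂ ^ 2 - y₂ * y₄ = 0) ∨ (y₂ = 0 ∧ y₃ = 0 ∧ y₅ = 0) ∨ (y₂ = 0 ∧ y₄ = 0 ∧ y₅ = 0) ∨
        (y₁ = 0 ∧ y₅ = 0 ∧ y₂ = y₄)) := by
  constructor
  · rintro ⟨h1, h2, h3, h4, h5⟩
    by_cases hy5 : y₅ = 0
    · subst hy5
      have h1' : y₂ * (y₂ - y₄) = 0 := by linear_combination h1
      by_cases hy2 : y₂ = 0
      · subst hy2
        have h5' : y₃ * y₄ = 0 := by linear_combination h5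
        rcases mul_eq_zero.1 h5' with h | h
        · exact Or.inr (Or.inl ⟨rfl, h, rfl⟩)
        · exact Or.inr (Or.inr (Or.inl ⟨rfl, h, rfl⟩))
      · have h24 : y₂ = y₄ := by
          rcases mul_eq_zero.1 h1' with h | h
          · exact absurd h hy2
          · linear_combination h
        have hy1 : y₁ = 0 := by
          rcases mul_eq_zero.1 h4 with h | h
          · exact h
          · exact absurd h hy2
        exact Or.inr (Or.inr (Or.inr ⟨hy1, rfl, h24⟩))
    · have hy1 : y₁ = 0 := by
        rcases mul_eq_zero.1 h2 with h | h
        · exact h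
        · exact absurd h hy5
      have hy3 : y₃ = 0 := by
        rcases mul_eq_zero.1 h3 with h | h
        · exact h
        · exact absurd h hy5
      exact Or.inl ⟨hy1, hy3, h1⟩
  · rintro (⟨rfl, rfl, h⟩ | ⟨rfl, rfl, rfl⟩ | ⟨rfl, rfl, rfl⟩ | ⟨rfl, rfl, rfl⟩)
    · exact ⟨h, by ring, by ring, by ring, by ring⟩
    · exact ⟨by ring, by ring, by ring, by ring, by ring⟩
    · exact ⟨by ring, by ring, by ring, by ring, by ring⟩
    · exact ⟨by ring, by ring, by ring, by ring, by ring⟩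

/-- (T16d)(iii) for the weight w = (1,1,1,2,5,3) on (y₁,…,y₆) the w-leading monomials of the five Pfaffians are y₅y₆, y₁y₅, y₃y₅, y₁y₂, y₃y₄:
w(y₅y₆) = 8 > w(y₂y₄) = 3 > w(y₂²) = 2 and w(y₃y₄) = 3 > w(y₂y₃) = 2 (the other three are monomials). -/
theorem leading_terms_w : (5 + 3 > 1 + 2 ∧ 5 + 3 > 1 + 1 ∧ 1 + 2 > 1 + 1) := by decide

/-! ## (T16b) W₀ = five coordinate planes in y = the Stanley–Reisner scheme of a 2-disk Δ (PROVED combinatorics) -/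

/-- vertices 1..6 ↔ y₁..y₆; the facets of Δ are the complements of the vanishing triples of the five planes
Π(1,1) = V(y₁,y₃,y₅), Π(1,5) = V(y₁,y₄,y₅), Π(7,1) = V(y₂,y₃,y₅), Π(7,5) = V(y₂,y₄,y₅), Π′ = V(y₁,y₃,y₆). -/
def vertices : List ℕ := [1, 2, 3, 4, 5, 6]
/-- the vanishing triples {j : y_j = 0 on the plane} of Π(1,1), Π(1,5), Π(7,1), Π(7,5), Π′. -/
def vanishingTriples : List (List ℕ) := [[1, 3, 5], [1, 4, 5], [2, 3, 5], [2, 4, 5], [1, 3, 6]]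
/-- the facets of Δ = complements of the vanishing triples. -/
def facets : List (List ℕ) := vanishingTriples.map fun t => vertices.filter fun v => v ∉ t

/-- facets of Δ: 246, 236, 146, 136, 245 (engine A (T16b)). -/
theorem facets_eq : facets = [[2, 4, 6], [2, 3, 6], [1, 4, 6], [1, 3, 6], [2, 4, 5]] := by decide

/-- s is a face of Δ iff it lies in some facet. -/
def isFace (s : List ℕ) : Bool := facets.any fun F => s.all fun v => decide (v ∈ F)
/-- the faces with c vertices -/
def faces (c : ℕ) : List (List ℕ) := vertices.sublists.filter fun s => s.length = c ∧ isFace s = true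
/-- minimal non-faces (= squarefree generators of the Stanley–Reisner ideal I_Δ = I_{W₀}) -/
def minimalNonFaces : List (List ℕ) :=
  vertices.sublists.filter fun s => isFace s = false ∧ ∀ k ∈ List.range s.length, isFace (s.eraseIdx k) = true
/-- number of facets containing the edge e -/
def edgeMult (e : List ℕ) : ℕ := (facets.filter fun F => e.all fun v => decide (v ∈ F)).length

/-- f(Δ) = (6, 10, 5) and dim Δ = 2 (no 4-faces). -/
theorem fVector : (faces 1).length = 6 ∧ (faces 2).length = 10 ∧ (faces 3).length = 5 ∧ (faces 4).length = 0 := by decide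

/-- I_{W₀} = I_Δ is generated by the five NON-EDGES y₁y₂, y₁y₅, y₃y₄, y₃y₅, y₅y₆ and has no generator of degree ≥ 3 (= B's 'generated by its 5
quadrics' and = the w-leading terms of Pf(M⁰), so in_w(Pf M⁰) ⊇ I_{W₀}). -/
theorem stanleyReisner_generators :
    minimalNonFaces.length = 5 ∧ ([[1, 2], [1, 5], [3, 4], [3, 5], [5, 6]].all fun s => decide (s ∈ minimalNonFaces)) = true := by decide

/-- Δ is a triangulated DISK: every edge lies in 1 or 2 facets; the boundary edges (multiplicity 1) are 13, 14, 23, 25, 45 — a pentagon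
2-3-1-4-5 on the vertices 1..5 (each in exactly two boundary edges), the interior edges 16, 26, 36, 46, 24 all contain 6 or are 24, vertex 6 is
interior; χ = 6 − 10 + 5 = 1. Hence S/I_{W₀} is Cohen–Macaulay but not Gorenstein (cited: Hochster/Stanley), consistent with W₀ not being a Pfaffian itself. -/
theorem disk :
    (∀ e ∈ faces 2, edgeMult e = 1 ∨ edgeMult e = 2) ∧
    (faces 2).filter (fun e => edgeMult e = 1) = [[1, 3], [2, 3], [1, 4], [2, 5], [4, 5]] ∧
    (∀ v ∈ [1, 2, 3, 4, 5], (((faces 2).filter fun e => edgeMult e = 1).filter fun e => v ∈ e).length = 2) ∧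
    (((faces 2).filter fun e => edgeMult e = 1).filter fun e => 6 ∈ e).length = 0 ∧
    (6 + 5 : ℤ) - 10 = 1 := by
  decide

/-- exponent vectors of the monomials of degree `deg` in `v` variables -/
def expVecs : ℕ → ℕ → List (List ℕ)
  | 0, deg => if deg = 0 then [[]] else []
  | v + 1, deg => (List.range (deg + 1)).flatMap fun e => (expVecs v (deg - e)).map fun t => e :: t
/-- a monomial y^a survives in S/I_Δ iff its support is a face -/
def survives (a : List ℕ) : Bool := isFace ((List.range 6).filterMap fun k => if a.getD k 0 = 0 then none else some (k + 1))
/-- HF(S/I_{W₀})(k) by monomial count -/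
def hfCount (k : ℕ) : ℕ := ((expVecs 6 k).filter fun a => survives a = true).length

/-- HF(W₀)(k) = (5k²+5k+2)/2 = HF(dP5)(k): monomial count for k ≤ 4 gives (1, 6, 16, 31, 51) (engine A (T16b), engine B (H) 'HF(W₀⁴)(1..5) = (6,16,31,51,76)'). -/
theorem hf_W0_count : (List.range 5).map hfCount = [1, 6, 16, 31, 51] := by decide

/-- STANLEY's formula for a Stanley–Reisner ring, HF(k) = Σ_i f_i C(k−1, i) (k ≥ 1), with f = (6,10,5): 6 + 10(k−1) + 5C(k−1,2) = (5k²+5k+2)/2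
for ALL k ≥ 1 (written with j = k − 1 and doubled to stay in ℕ). -/
theorem stanley_hf (j : ℕ) : 2 * (6 + 10 * j + 5 * j.choose 2) = 5 * (j + 1) ^ 2 + 5 * (j + 1) + 2 := by
  induction j with
  | zero => decide
  | succ j ih =>
    rw [Nat.choose_succ_succ, Nat.choose_one_right]
    nlinarith [ih]

/-- the common Hilbert function h(k) = (5k²+5k+2)/2 of W₀, of Pf(M⁰) and of the quintic del Pezzo surface (k ≥ 0). -/
def hfDP5 (k : ℕ) : ℕ := (5 * k ^ 2 + 5 * k + 2) / 2

/-- (T16d)(ii) the BUCHSBAUM–EISENBUD Hilbert function of a grade-3 Pfaffian ideal of a 5 × 5 skew matrix of linear forms in 6 variables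
(resolution 0 → S(−5) → S(−3)⁵ → S(−2)⁵ → S): C(k+5,5) − 5C(k+3,5) + 5C(k+2,5) − C(k,5) = (5k²+5k+2)/2, checked for k ≤ 12 — both sides are
polynomials in k of degree ≤ 5 valid for every k ≥ 0 (C(m,5) = m(m−1)⋯(m−4)/120 for all m ≥ 0), so agreement at 13 values is the identity.
Values (1, 6, 16, 31, 51, 76, 106, 141, 181, …) = engine A's direct computation k ≤ 6 and B's (D) dim I_k = (5, 25, 75, 176). -/
theorem buchsbaumEisenbud_hf :
    ∀ k ∈ List.range 13, ((k + 5).choose 5 + 5 * (k + 2).choose 5 : ℤ) - 5 * (k + 3).choose 5 - k.choose 5 = hfDP5 k := by decide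

/-- the values themselves and dim I_k = C(k+5,5) − HF(k) = (5, 25, 75, 176, 356) for k = 2..6 (A = B). -/
theorem hf_values :
    (List.range 9).map hfDP5 = [1, 6, 16, 31, 51, 76, 106, 141, 181] ∧
    ([2, 3, 4, 5, 6].map fun k => (k + 5).choose 5 - hfDP5 k) = [5, 25, 75, 176, 356] := by decide

/-! ## (T16a)/(C5 K2)/R32: Gr(2,5)-section numbers and the dimension certificate 110 / 277 / 596 (PROVED arithmetic) -/

/-- Hilbert polynomial of Gr(2,5) ⊂ ℙ⁹: h_Gr(k) = (k+1)(k+2)²(k+3)²(k+4)/144. -/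
def hGr (k : ℕ) : ℕ := (k + 1) * (k + 2) ^ 2 * (k + 3) ^ 2 * (k + 4) / 144
/-- cumulative sums: HF of a cone = cumulative HF of its base. -/
def cumul (f : ℕ → ℕ) (k : ℕ) : ℕ := ((List.range (k + 1)).map f).sum

/-- h_Gr(0..4) = 1, 10, 50, 175, 490; Koszul sections: h⁰(O_{dP5}(4)) = 490 − 4·175 + 6·50 − 4·10 + 1 = 51, h⁰(O_{V₅}(4)) = 490 − 3·175 + 3·50 − 10
= 105, h⁰(O_{Gr∩ℙ⁷}(4)) = 490 − 2·175 + 50 = 190 (R32(a)); checks HF(2) = 31 = 36 − 5 and h⁰(O_{V₅}(1)) = 7, (2) = 23 = 28 − 5. -/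
theorem grassmannian_sections :
    (List.range 5).map hGr = [1, 10, 50, 175, 490] ∧
    (hGr 4 + 6 * hGr 2 + hGr 0 = 51 + 4 * hGr 3 + 4 * hGr 1) ∧ (hGr 4 + 3 * hGr 2 = 105 + 3 * hGr 3 + hGr 1) ∧
    (hGr 4 + hGr 2 = 190 + 2 * hGr 3) ∧ (hGr 2 + hGr 0 = 31 + 2 * hGr 1) ∧ (36 - 5 = 31) ∧
    (hGr 1 = 7 + 3 * hGr 0) ∧ (hGr 2 + 3 * hGr 0 = 23 + 3 * hGr 1) ∧ (28 - 5 = 23) := by decide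

/-- the same three numbers from the degeneration side: HF(W₀ⁿ)(k) = cumulative HF for the cones (T16b): (1,6,16,31,51,76) → (1,7,23,54,105,181) →
(1,8,31,85,190,371); in particular h(4) = 51 / 105 / 190 = the dP5 / V₅ / Gr(2,5)∩ℙ⁷ values (= (K2)'s HF(W)(1..4) = (6,16,31,51) / (7,23,54,105) / (8,31,85,190)). -/
theorem cone_hilbert_functions :
    (List.range 6).map hfDP5 = [1, 6, 16, 31, 51, 76] ∧
    (List.range 6).map (cumul hfDP5) = [1, 7, 23, 54, 105, 181] ∧
    (List.range 6).map (cumul (cumul hfDP5)) = [1, 8, 31, 85, 190, 371] := by decide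

/-- DIMENSION CERTIFICATE ARITHMETIC (three routes agree: A/B generic rank (K2)/(T16a), R32 by hand): dim S₄ = C(n+5,4) = 126 / 330 / 715;
h⁰(I_W(4)) = 126 − 51 = 75, 330 − 105 = 225, 715 − 190 = 525; family of sections 35 = dim PGL₆ (Aut dP5 finite), 52 = 7 + 48 − 3 (hyperplane of ℙ⁷,
PGL₇, Aut V₅ = PGL₂), 71 = 16 + 63 − 8 (Gr(8,10), PGL₈, 8-dimensional stabiliser 24 − 16 of a generic pencil of 2-forms on ℂ⁵); orbit rank of a
single quartic = dim J₄ = (n+2)² = 36 / 64 / 100; totals 110 / 277 / 596 = dim S₄ − rank M_{[Z]+[Π′]} = 126 − 16 / 330 − 53 / 715 − 119 = dim T. -/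
theorem dimension_certificate :
    Nat.choose 9 4 = 126 ∧ Nat.choose 11 4 = 330 ∧ Nat.choose 13 4 = 715 ∧
    126 - 51 = 75 ∧ 330 - 105 = 225 ∧ 715 - 190 = 525 ∧
    6 ^ 2 - 1 = 35 ∧ 7 + (7 ^ 2 - 1) - 3 = 52 ∧ 2 * (10 - 2) + (8 ^ 2 - 1) - (24 - 16) = 71 ∧
    (4 + 2) ^ 2 = 36 ∧ (6 + 2) ^ 2 = 64 ∧ (8 + 2) ^ 2 = 100 ∧
    75 + 35 = 110 ∧ 225 + 52 = 277 ∧ 525 + 71 = 596 ∧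
    126 - 16 = 110 ∧ 330 - 53 = 277 ∧ 715 - 119 = 596 := by decide

/-! ## (T18)/(T18d)/R31/R32/R34: the (−)-cells — slice accounting (PROVED arithmetic; the order-2 obstruction is cited evidence) -/

/-- per n: (dim S₄, dim J₄, rank M_Z, rank M_Π′, stacked rank, rank M_{[Z]±[Π′]}) — A exact over ℚ(ζ₈) = B = R (two primes). -/
def minusCells : List (ℕ × ℕ × ℕ × ℕ × ℕ × ℕ) := [(126, 36, 11, 6, 17, 16), (330, 64, 36, 19, 54, 53), (715, 100, 83, 45, 120, 119)]

/-- e = stack − rank = 1 in all three cells; dim T_Z ∩ T_Π′ = dim S₄ − stack = 109 / 276 / 595 = dim T − 1 (dim T = dim S₄ − rank = 110 / 277 / 596),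
so 'every component through X_F has dim ≤ dim T_Z ∩ T_Π′' is exactly 'NOT a component of dimension dim T'; in reduced quartics R₄ = S₄/J₄
(dim 90 / 266 / 615) the intersection has dimension 73 / 212 / 495 (R32(b): 73 + 36 = 109; R34(c): 495 + 100 = 595); transversality
stack = rank Z + rank Π′ holds for n = 4 only (17 = 11 + 6; 54 + 1 = 36 + 19; 120 + 8 = 83 + 45). -/
theorem minusCells_accounting :
    (minusCells.map fun c => c.2.2.2.2.1 - c.2.2.2.2.2) = [1, 1, 1] ∧
    (minusCells.map fun c => c.1 - c.2.2.2.2.1) = [109, 276, 595] ∧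
    (minusCells.map fun c => c.1 - c.2.2.2.2.2) = [110, 277, 596] ∧
    (minusCells.map fun c => c.1 - c.2.1) = [90, 266, 615] ∧
    (minusCells.map fun c => c.1 - c.2.1 - c.2.2.2.2.1) = [73, 212, 495] ∧
    (minusCells.map fun c => c.2.2.1 + c.2.2.2.1 - c.2.2.2.2.1) = [0, 1, 8] := by decide

/-- fat point of length 2: Hilbert–Samuel function (1, 2, 2, …) of the slice germ with ONE first-order direction (e = 1) and m² ⊆ I has
length 1 + 1 = 2; the smooth (+)-control has HS (1, 2, 3, 4) = k + 1 (a curve germ). Bookkeeping only. -/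
theorem fat_point_length : 1 + 1 = 2 ∧ (List.range 4).map (· + 1) = [1, 2, 3, 4] := by decide

/-! ## (T16b)/(T16c) the pencil identities on the Fermat quartic K3 and W₀ ⊂ X_F (PROVED) -/

/-- κ = ζ + ζ⁷ and i = ζ² satisfy κ² = 2, i² = −1 when ζ⁴ = −1 (inputs of HodgeLocusCensusAokiShiodaRows.block_d4). -/
theorem kappa_i_relations (ζ : R) (h4 : ζ ^ 4 = -1) : (ζ + ζ ^ 7) ^ 2 = 2 ∧ (ζ ^ 2) ^ 2 = -1 := by
  constructor
  · linear_combination (ζ ^ 2 * (ζ ^ 8 - ζ ^ 4 + 1) + 2 * (ζ ^ 4 - 1)) * h4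
  · linear_combination h4

/-- (T16b) (f₁ + g₂) + (f₂ − g₁) = 2·y₁y₂ and (f₁ + g₂) − (f₂ − g₁) = 2·y₃y₄ with f₁ = x₂² − κx₀x₁, g₁ = x₂² + κx₀x₁, f₂ = x₀² + x₁² + i x₃²,
g₂ = x₀² + x₁² − i x₃², κ = ζ + ζ⁷, i = ζ², y₁ = x₀ − ζx₁, y₂ = x₀ − ζ⁷x₁, y₃ = x₂ − ζx₃, y₄ = x₂ + ζx₃ (ζ⁸ = 1): the pencil member
E_{(1:−1)} = V(f₁ + g₂, f₂ − g₁) = V(y₁y₂, y₃y₄) is the four lines L(1,1) ∪ L(1,5) ∪ L(7,1) ∪ L(7,5) (x₂ + ζx₃ = x₂ − ζ⁵x₃). -/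
theorem pencil_member_is_four_lines (ζ x₀ x₁ x₂ x₃ : R) (h8 : ζ ^ 8 = 1) :
    ((x₂ ^ 2 - (ζ + ζ ^ 7) * x₀ * x₁) + (x₀ ^ 2 + x₁ ^ 2 - ζ ^ 2 * x₃ ^ 2)) + ((x₀ ^ 2 + x₁ ^ 2 + ζ ^ 2 * x₃ ^ 2) - (x₂ ^ 2 + (ζ + ζ ^ 7) * x₀ * x₁))
        = 2 * ((x₀ - ζ * x₁) * (x₀ - ζ ^ 7 * x₁)) ∧
    ((x₂ ^ 2 - (ζ + ζ ^ 7) * x₀ * x₁) + (x₀ ^ 2 + x₁ ^ 2 - ζ ^ 2 * x₃ ^ 2)) - ((x₀ ^ 2 + x₁ ^ 2 + ζ ^ 2 * x₃ ^ 2) - (x₂ ^ 2 + (ζ + ζ ^ 7) * x₀ * x₁))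
        = 2 * ((x₂ - ζ * x₃) * (x₂ + ζ * x₃)) ∧
    (x₂ + ζ * x₃ = x₂ - ζ ^ 5 * x₃ ↔ ζ * x₃ * (ζ ^ 4 + 1) = 0) := by
  refine ⟨?_, ?_, ?_⟩
  · linear_combination (-2 * x₁ ^ 2) * h8
  · ring
  · constructor
    · intro h; linear_combination h
    · intro h; linear_combination h

/-- (T16c) the pencil E_{(s:t)} = V(s f₁ − t g₂, s f₂ + t g₁) lies on S_F: (s f₁ − t g₂)·g₁ + (s f₂ + t g₁)·g₂ = s·(f₁g₁ + f₂g₂) (= s·F_S by the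
Aoki–Shioda block identity), for arbitrary ring elements. -/
theorem pencil_on_surface (s t f₁ f₂ g₁ g₂ : R) : (s * f₁ - t * g₂) * g₁ + (s * f₂ + t * g₁) * g₂ = s * (f₁ * g₁ + f₂ * g₂) := by ring

/-- a twisted pair with ODD exponent kills its Fermat block: (ζ^{2a+1} x)⁴ + x⁴ = 0 when ζ⁴ = −1. -/
theorem odd_twist_pair (ζ x : R) (h4 : ζ ^ 4 = -1) (a : ℕ) : (ζ ^ (2 * a + 1) * x) ^ 4 + x ^ 4 = 0 := by
  have h : (ζ ^ (2 * a + 1)) ^ 4 = -1 := by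
    rw [← pow_mul, show (2 * a + 1) * 4 = 4 * (2 * a + 1) by ring, pow_mul, h4]
    exact Odd.neg_one_pow ⟨a, rfl⟩
  rw [mul_pow, h]; ring

/-- W₀ ⊂ X_F: each of the five planes V(x₀ − ζ^α x₁, x₂ − ζ^β x₃, x₄ − ζ^γ x₅) with α, β, γ odd ((1,1,1), (1,5,1), (7,1,1), (7,5,1), (1,1,3)) lies on
the Fermat quartic fourfold: substituting the parametrisation, F = Σ_{pairs} ((ζ^{odd} x)⁴ + x⁴) = 0 (engine A check 'ζ^{4a}+1 = 0, 5/5'); the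
same with extra pairs (x₆ − ζx₇), (x₈ − ζx₉) for W₀⁶, W₀⁸. -/
theorem planes_on_fermat (ζ x₁ x₃ x₅ : R) (h4 : ζ ^ 4 = -1) (a b c : ℕ) :
    (ζ ^ (2 * a + 1) * x₁) ^ 4 + x₁ ^ 4 + ((ζ ^ (2 * b + 1) * x₃) ^ 4 + x₃ ^ 4) + ((ζ ^ (2 * c + 1) * x₅) ^ 4 + x₅ ^ 4) = 0 := by
  rw [odd_twist_pair ζ x₁ h4 a, odd_twist_pair ζ x₃ h4 b, odd_twist_pair ζ x₅ h4 c]; ring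

/-- the exponent table of the five planes as (α, β, γ) and its translation to the schema's twists a = (α−1)/2 etc.: all exponents odd, and the
`plane44` arguments used in the typed rows above are ((α−1)/2, (β−1)/2, (γ−1)/2). -/
theorem plane_exponents :
    ([(1, 1, 1), (1, 5, 1), (7, 1, 1), (7, 5, 1), (1, 1, 3)].map fun (t : ℕ × ℕ × ℕ) => ((t.1 - 1) / 2, (t.2.1 - 1) / 2, (t.2.2 - 1) / 2))
      = [(0, 0, 0), (0, 2, 0), (3, 0, 0), (3, 2, 0), (0, 0, 1)] ∧
    ([(1, 1, 1), (1, 5, 1), (7, 1, 1), (7, 5, 1), (1, 1, 3)].all fun (t : ℕ × ℕ × ℕ) => t.1 % 2 == 1 && t.2.1 % 2 == 1 && t.2.2 % 2 == 1) = true := by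
  decide

end Summit.HodgeConjecture.HodgeConjecture.HodgeLocus.Census.GrSection
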